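import Mathlib
import HarnessLib

/-!
# Powers of `x` in the Chebyshev basis (Rivlin, Exercises 1.5.31–1.5.32)

Source: T. J. Rivlin, *The Chebyshev Polynomials*, Wiley 1974, Exercises 1.5.31–1.5.32, pp. 33–34
of the held scan `book:rivlinnd-chebyshev-polynomials` (bib key `Rivlin1974`):

* Ex. 1.5.31 (1.147)–(1.148): if `x^n = Σ'_{j=0}^{n} B_j^{(n)} T_j(x)` then
  `B_{n−2k}^{(n)} = 2^{1−n} C(n, k)` and `B_j^{(n)} = 0` for `j ≠ n − 2k`;
* Ex. 1.5.32: the resulting conversion of `Σ a_k x^k` into a Chebyshev sum.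

With Mathlib's `ℤ`-indexed Chebyshev polynomials (`T_{−m} = T_m`, `Polynomial.Chebyshev.T_neg`)
the primed sum and the halving of the `T_0` term disappear and (1.147)–(1.148) become the single
division-free identity, valid over every commutative ring,
`(2X)^n = Σ_{k=0}^{n} C(n, k) T_{n−2k}` (`two_mul_X_pow_eq_sum_T`), i.e. the polynomial form of
`(2 cos θ)^n = Σ_k C(n, k) cos (n − 2k)θ` (which, together with the pointwise form on `[−1, 1]`,
is already `Literature.Probability.MarkovChains.VaropoulosCarneBound.two_mul_cos_pow_eq_sum` /
`pow_eq_sum_choose_mul_chebyshev` and is cited, not restated; the hyperbolic reading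
`two_mul_cosh_pow_eq_sum` is recorded); the terms `k` and `n − k`
carry the same `T_{|n−2k|}`, which is Rivlin's `2^{1−n} C(n, k)` after division by `2^n`, and only
indices `j ≡ n (mod 2)` occur. The Dickson/Vieta form `2 x^n = Σ_k C(n, k) C_{n−2k}(x)` for
Mathlib's `Polynomial.Chebyshev.C` (`C_m(y + y⁻¹) = y^m + y^{−m}`) is `two_mul_X_pow_eq_sum_C`.
Both are proved by Rivlin's induction (`x T_j = (T_{j+1} + T_{j−1})/2` and Pascal's rule, packaged
once as `sum_choose_succ_mul_apply_sub_two_mul`, a corollary of Mathlib's `Finset.sum_choose_succ_mul`).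
Ex. 1.5.32 is the coefficientwise consequence `two_mul_eq_sum_coeff_mul_sum_C` /
`eq_sum_coeff_mul_sum_T` (before collecting equal indices).
-/
open Polynomial Finset

namespace Literature.Algebra.Polynomial.ChebyshevPowerExpansion

variable {R : Type*} [CommRing R]

/-! ## Pascal's rule for sums indexed by `n − 2k` -/

/-- Pascal step for sums over the index `n − 2k ∈ ℤ`:
`Σ_{k ≤ n+1} C(n+1, k) G(n+1−2k) = Σ_{k ≤ n} C(n, k) (G(n−2k+1) + G(n−2k−1))`.
[cite: Rivlin1974, Sect. 1.5 Ex. 1.5.31 (induction step)] -/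
theorem sum_choose_succ_mul_apply_sub_two_mul (G : ℤ → R[X]) (n : ℕ) :
    ∑ k ∈ range (n + 1 + 1), (((n + 1).choose k : ℕ) : R[X]) * G (((n + 1 : ℕ) : ℤ) - 2 * k)
      = ∑ k ∈ range (n + 1), ((n.choose k : ℕ) : R[X])
          * (G ((n : ℤ) - 2 * k + 1) + G ((n : ℤ) - 2 * k - 1)) := by
  have h := Finset.sum_choose_succ_mul (R := R[X]) (fun i j => G ((j : ℤ) - i)) n
  convert h using 1
  · refine sum_congr rfl fun k hk => ?_
    have hk' : k ≤ n + 1 := Nat.lt_succ_iff.mp (mem_range.mp hk)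
    rw [show ((n + 1 : ℕ) : ℤ) - 2 * k = ((n + 1 - k : ℕ) : ℤ) - k from by
      push_cast [Nat.cast_sub hk']; ring]
  · rw [← sum_add_distrib]
    refine sum_congr rfl fun k hk => ?_
    have hk' : k ≤ n := Nat.lt_succ_iff.mp (mem_range.mp hk)
    rw [mul_add, show (n : ℤ) - 2 * k + 1 = ((n + 1 - k : ℕ) : ℤ) - k from by
        push_cast [Nat.cast_sub (Nat.le_succ_of_le hk')]; ring,
      show (n : ℤ) - 2 * k - 1 = ((n - k : ℕ) : ℤ) - ((k + 1 : ℕ) : ℤ) from by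
        push_cast [Nat.cast_sub hk']; ring]

/-! ## Ex. 1.5.31: `x^n` in the Chebyshev basis -/

/-- Ex. 1.5.31 (1.147)–(1.148), `ℤ`-indexed form over any commutative ring:
`(2X)^n = Σ_{k=0}^{n} C(n, k) T_{n−2k}`. [cite: Rivlin1974, Sect. 1.5 Ex. 1.5.31 (1.147)-(1.148)] -/
theorem two_mul_X_pow_eq_sum_T (n : ℕ) :
    ((2 : R[X]) * X) ^ n
      = ∑ k ∈ range (n + 1), ((n.choose k : ℕ) : R[X]) * Chebyshev.T R ((n : ℤ) - 2 * k) := by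
  induction n with
  | zero => simp
  | succ n ih =>
      rw [sum_choose_succ_mul_apply_sub_two_mul (fun m => Chebyshev.T R m) n]
      have hX : ∀ m : ℤ, (2 * X : R[X]) * Chebyshev.T R m
          = Chebyshev.T R (m + 1) + Chebyshev.T R (m - 1) := by
        intro m
        rw [Chebyshev.T_add_one]
        ring
      rw [pow_succ, ih, sum_mul]
      refine sum_congr rfl fun k _ => ?_
      rw [mul_assoc, mul_comm (Chebyshev.T R _) (2 * X), hX]

/-- The Dickson–Vieta form of Ex. 1.5.31: `2 X^n = Σ_{k=0}^{n} C(n, k) C_{n−2k}` for the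
polynomials `C_m` (`C_m(2x) = 2 T_m(x)`). [cite: Rivlin1974, Sect. 1.5 Ex. 1.5.31 (1.147)-(1.148)] -/
theorem two_mul_X_pow_eq_sum_C (n : ℕ) :
    (2 : R[X]) * X ^ n
      = ∑ k ∈ range (n + 1), ((n.choose k : ℕ) : R[X]) * Chebyshev.C R ((n : ℤ) - 2 * k) := by
  induction n with
  | zero => simp
  | succ n ih =>
      rw [sum_choose_succ_mul_apply_sub_two_mul (fun m => Chebyshev.C R m) n]
      have hX : ∀ m : ℤ, (X : R[X]) * Chebyshev.C R m
          = Chebyshev.C R (m + 1) + Chebyshev.C R (m - 1) := by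
        intro m
        rw [Chebyshev.C_add_one]
        ring
      rw [pow_succ, ← mul_assoc, ih, sum_mul]
      refine sum_congr rfl fun k _ => ?_
      rw [mul_assoc, mul_comm (Chebyshev.C R _) X, hX]

/-- (1.147) literally, when `2` is invertible: `X^n = 2^{−n} Σ_k C(n, k) T_{n−2k}` (the terms `k`
and `n − k` both carry `T_{|n−2k|}`, giving Rivlin's `B_{n−2k}^{(n)} = 2^{1−n} C(n, k)` in the
primed sum). [cite: Rivlin1974, Sect. 1.5 Ex. 1.5.31 (1.147)-(1.148)] -/
theorem X_pow_eq_invOf_two_pow_mul_sum_T [Invertible (2 : R)] (n : ℕ) :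
    (X : R[X]) ^ n
      = C (⅟ (2 : R) ^ n) * ∑ k ∈ range (n + 1), ((n.choose k : ℕ) : R[X])
          * Chebyshev.T R ((n : ℤ) - 2 * k) := by
  rw [← two_mul_X_pow_eq_sum_T, mul_pow, ← mul_assoc,
    show C (⅟ (2 : R) ^ n) * (2 : R[X]) ^ n = 1 from by
      rw [show (2 : R[X]) = C (2 : R) from (map_ofNat C 2).symm, ← C_pow, ← C_mul, ← mul_pow,
        invOf_mul_self, one_pow, C_1],
    one_mul]

/-- Only indices of the parity of `n` occur: every index `n − 2k` is congruent to `n` modulo `2`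
(`B_j^{(n)} = 0` for `j ≠ n − 2k`). [cite: Rivlin1974, Sect. 1.5 Ex. 1.5.31] -/
theorem index_sub_two_mul_modEq (n k : ℕ) : ((n : ℤ) - 2 * k) ≡ n [ZMOD 2] := by
  rw [Int.ModEq, Int.sub_mul_emod_self_left]

/-! ## Hyperbolic reading

The trigonometric reading `(2 cos θ)^n = Σ_k C(n, k) cos (n − 2k)θ` and the pointwise form
`s^n = Σ_k C(n, k) 2^{−n} T_{n−2k}(s)` on `[−1, 1]` are already in the tree as
`Literature.Probability.MarkovChains.VaropoulosCarneBound.two_mul_cos_pow_eq_sum` and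
`Literature.Probability.MarkovChains.VaropoulosCarneBound.pow_eq_sum_choose_mul_chebyshev`
(Lyons–Peres Lemma 13.5); they are cited, not restated. -/

/-- `(2 cosh θ)^n = Σ_{k=0}^{n} C(n, k) cosh (n − 2k)θ`, the evaluation of Ex. 1.5.31 at
`x = cosh θ` (the `cos` companion is `VaropoulosCarneBound.two_mul_cos_pow_eq_sum`).
[cite: Rivlin1974, Sect. 1.5 Ex. 1.5.31 (1.147)-(1.148)] -/
theorem two_mul_cosh_pow_eq_sum (θ : ℝ) (n : ℕ) :
    (2 * Real.cosh θ) ^ n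
      = ∑ k ∈ range (n + 1), (n.choose k : ℝ) * Real.cosh (((n : ℤ) - 2 * k : ℤ) * θ) := by
  have h := congrArg (Polynomial.eval (Real.cosh θ)) (two_mul_X_pow_eq_sum_T (R := ℝ) n)
  simp only [eval_pow, eval_mul, eval_ofNat, eval_X, eval_finsetSum, eval_natCast,
    Chebyshev.T_real_cosh] at h
  exact h

/-! ## Ex. 1.5.32: converting a power sum into a Chebyshev sum -/

/-- Ex. 1.5.32 (coefficientwise, before collecting equal indices): for `p = Σ a_i x^i`,
`2 p = Σ_i a_i Σ_k C(i, k) C_{i−2k}`. [cite: Rivlin1974, Sect. 1.5 Ex. 1.5.32] -/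
theorem two_mul_eq_sum_coeff_mul_sum_C (p : R[X]) :
    2 * p = ∑ i ∈ range (p.natDegree + 1), C (p.coeff i)
      * ∑ k ∈ range (i + 1), ((i.choose k : ℕ) : R[X]) * Chebyshev.C R ((i : ℤ) - 2 * k) := by
  conv_lhs => rw [p.as_sum_range_C_mul_X_pow, mul_sum]
  refine sum_congr rfl fun i _ => ?_
  rw [mul_left_comm, two_mul_X_pow_eq_sum_C]

/-- Ex. 1.5.32 with `2` invertible: `p = Σ_i a_i 2^{−i} Σ_k C(i, k) T_{i−2k}`, whose collection by
equal `|i − 2k|` is Rivlin's `A_k = 2^{1−k} [a_k + Σ_j C(k+2j, j) a_{k+2j} / 2^{2j}]`.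
[cite: Rivlin1974, Sect. 1.5 Ex. 1.5.32] -/
theorem eq_sum_coeff_mul_sum_T [Invertible (2 : R)] (p : R[X]) :
    p = ∑ i ∈ range (p.natDegree + 1), C (p.coeff i * ⅟ (2 : R) ^ i)
      * ∑ k ∈ range (i + 1), ((i.choose k : ℕ) : R[X]) * Chebyshev.T R ((i : ℤ) - 2 * k) := by
  conv_lhs => rw [p.as_sum_range_C_mul_X_pow]
  refine sum_congr rfl fun i _ => ?_
  rw [X_pow_eq_invOf_two_pow_mul_sum_T, ← mul_assoc, ← C_mul]

end Literature.Algebra.Polynomial.ChebyshevPowerExpansion
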